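import Summits.BirchSwinnertonDyer.BirchSwinnertonDyer.Theorems.ByReductionTypeAtTwoRankOneAtTwoBigImageOddLocalOneDoorBottomLeavesRec
import Summits.BirchSwinnertonDyer.BirchSwinnertonDyer.Theorems.ByReductionTypeAtTwoRankOneAtTwoBigImageOddLocalOneDoorBottomCebotarev
import Summits.BirchSwinnertonDyer.BirchSwinnertonDyer.Theorems.GenusKolyvaginAtTwoVisiblePairAtTwoDefs
import Literature.NumberTheory.EllipticCurves.NoConductorOne
import HarnessLib

/-!
# Route ByReductionTypeAtTwo, crux `RankOneAtTwoBigImageOddLocal` (stmt-BirchSwinnertonDyer-23715), LINE v8.9 `one_door_analytic`: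
# the fields `rec₁`, `rec₂`, `ceb₁`, `ceb₂`, `ceb₂'` of `FirstDescentInput` for the CANONICAL choice `Kol := kolPrime W K 1`, `pl := pl`

Width prover seat `bsd-line-fkl-p2` g10 (2026-08-28), `--supports stmt-BirchSwinnertonDyer-23715` (helper).  THEOREMS ONLY.  BSD is not proved by
any of this.

The lead's record `FirstDescentInput W Wd` (`…OneDoorFirstDescentDefs.lean`, p641630) leaves the Kolyvagin-prime predicate `Kol` and the place
map `pl` abstract.  Route GenusKolyvaginAtTwo's visible-pair instance (`Theorems/GenusKolyvaginAtTwoVisiblePairAtTwoDefs.lean`, p638903 — the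
source of the remaining `c`-fields at `M = 1`) FIXES them: `VisiblePairAtTwo.kolPrime W K M ℓ` (prime, odd, `ℓ ∤ d_K`, good, `Frob_ℓ ∼ Frob_∞`
on `E[2^M]` and `E[2]`, index `≥ M`, inert) and `VisiblePairAtTwo.pl ℓ = Sum.inl v_ℓ`.  This file states the width seat's leaves for
EXACTLY that choice at `M = 1` and the finite error place `q₀ = Sum.inl v₀` (`v₀ ∋ q₀`, `q₀ ∣ d_K` the transposition prime of a minimal
`Δ_W < 0` door), so that they are literally the fields:

* §1 `kolPrime_one_of_isKolyvaginPrime` — a Gross–Kolyvagin prime produced by the Čebotarev leaves (`Zhang2014.IsKolyvaginPrime N W K 2 ℓ`,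
  `FrobEqFrobInfty W K 2 ℓ`, index `≥ 1`, `N_W ∣ N`) IS a `kolPrime W K 1 ℓ`; `ne_pl_of_dvd_discr` — `Sum.inl v₀ ≠ pl ℓ` (`ℓ ∤ d_K`, `q₀ ∣ d_K`);
* §2 `rec₁_field`, `rec₂_field` (globally minimal twin) — the fields `rec₁` / `rec₂` (`…OneDoorBottomLeavesRec`);
* §3 `ceb₁_field`, `ceb₂_field` — the fields `ceb₁` / `ceb₂`, UNCONDITIONAL on the `Δ_W < 0` habitat (`…OneDoorBottomCebotarev`);
  `ceb₂'_field_of_ne` — `ceb₂'` for the twist equation `W^{(d_K)}` in the generic case `hPsiKT (res s') ≠ res y`.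

References: [McCallumLMS1991] §3 Cor. 3.2, §5 Lemma 5.3; [GrossLMS1991] §§3, 10; [WZhang2014] Notations (xii).
-/

set_option autoImplicit false
-- the Theorems namespace of this sub repeats the summit name by design (D-0017 nested layout)
set_option linter.dupNamespace false

noncomputable section

open scoped Classical

namespace Summit.BirchSwinnertonDyer.BirchSwinnertonDyer.Theorems.RankOneAtTwoOneDoor

open WeierstrassCurve NumberField IsDedekindDomain Field Rat.HeightOneSpectrum
open Literature.NumberTheory.EllipticCurves Literature.NumberTheory.GaloisRepresentations
open Summit.BirchSwinnertonDyer.BirchSwinnertonDyer.Theorems.GenusExact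
open Summit.BirchSwinnertonDyer.BirchSwinnertonDyer.Theorems.GenusExact.VisiblePairAtTwo
open Summit.BirchSwinnertonDyer.BirchSwinnertonDyer.Theorems.GenusExact.SelmerDescent

section Rat

variable (N : ℕ) [NeZero N] (W : WeierstrassCurve ℚ) [W.IsElliptic] [W.IsGloballyMinimal]
  {K : Type} [Field K] [NumberField K]

/-! ## §1 Bookkeeping: the primes produced by the Čebotarev leaves are `kolPrime W K 1` -/

omit [NeZero N] in
/-- **A Gross–Kolyvagin prime at `2` of index `≥ 1` is a `kolPrime W K 1`** (`K` quadratic, `N_W ∣ N`): good reduction from `ℓ ∤ N`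
(`hasGoodReductionAtPrime_of_not_dvd_conductorNorm'`), inertia degree `2` above `ℓ` from `(ℓ)` prime in `𝓞_K` (`inertiaDeg_eq_two_of_span_isPrime`).
[cite: WZhang2014, Notations (xii)] [cite: GrossLMS1991, §3 (3.1)–(3.3)] -/
theorem kolPrime_one_of_isKolyvaginPrime (hN : W.conductorNorm ℤ ∣ N) (hK2 : Module.finrank ℚ K = 2) {ℓ : ℕ}
    (hKol : Zhang2014.IsKolyvaginPrime N W K 2 ℓ) (hFrob : FrobEqFrobInfty W K 2 ℓ) (hidx : 1 ≤ Zhang2014.kolyvaginIndex W 2 ℓ) :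
    kolPrime W K 1 ℓ := by
  obtain ⟨hℓ, hℓN, hℓd, hℓ2, hprime, -⟩ := hKol
  haveI : Fact ℓ.Prime := ⟨hℓ⟩
  have hgood : W.HasGoodReductionAtPrime ℓ :=
    W.hasGoodReductionAtPrime_of_not_dvd_conductorNorm' fun h => hℓN (dvd_trans h hN)
  refine ⟨hℓ, hℓ2, hℓd, hgood, by rw [pow_one]; exact hFrob, hFrob, hidx, fun w hw => ?_⟩
  exact inertiaDeg_eq_two_of_span_isPrime hK2 hℓ hprime (natCast_mem_primesEquiv_symm hℓ) hw

/-- The error place is not the place of a Kolyvagin prime: `q₀ ∣ d_K`, `ℓ ∤ d_K`. [folklore] -/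
theorem ne_primesEquiv_symm_of_dvd_discr {q₀ : ℕ} (hq₀ : q₀.Prime) (hq₀d : (q₀ : ℤ) ∣ NumberField.discr K)
    {v₀ : HeightOneSpectrum (𝓞 ℚ)} (hq₀v : (q₀ : 𝓞 ℚ) ∈ v₀.asIdeal) {ℓ : ℕ} (hℓ : ℓ.Prime) (hℓd : ¬ ((ℓ : ℤ) ∣ NumberField.discr K)) :
    v₀ ≠ (primesEquiv.symm ⟨ℓ, hℓ⟩ : HeightOneSpectrum (𝓞 ℚ)) := by
  intro h
  have h1 : v₀ = primesEquiv.symm ⟨q₀, hq₀⟩ := (natCast_prime_mem_iff_eq hq₀ v₀).mp hq₀v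
  have h2 : (⟨q₀, hq₀⟩ : Nat.Primes) = ⟨ℓ, hℓ⟩ := primesEquiv.symm.injective (h1.symm.trans h)
  have h3 : q₀ = ℓ := congrArg Subtype.val h2
  exact hℓd (h3 ▸ hq₀d)

/-! ## §2 The fields `rec₁` / `rec₂` for `Kol := kolPrime W K 1`, `pl := pl`, `q₀ := Sum.inl v₀` -/

/-- **Field `rec₁`** (`W` globally minimal, `Δ_W < 0`; error place `v₀ ∋ q₀ ∣ d_K`). [cite: GrossLMS1991, §10, Prop. 8.2] [cite: McCallumLMS1991, §5 Lemma 5.3] -/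
theorem rec₁_field (hΔ : W.Δ < 0) {q₀ : ℕ} (hq₀ : q₀.Prime) (hq₀d : (q₀ : ℤ) ∣ NumberField.discr K)
    {v₀ : HeightOneSpectrum (𝓞 ℚ)} (hq₀v : (q₀ : 𝓞 ℚ) ∈ v₀.asIdeal) :
    ∀ ℓ, kolPrime W K 1 ℓ → ∀ d : galH1Torsion W 2, (∀ v : RatPlace, v ≠ pl ℓ → v ≠ Sum.inl v₀ → d ∈ locAt W 2 v) → d ∉ locAt W 2 (pl ℓ) →
      ∀ s : galH1Torsion W 2, (∀ v : RatPlace, v ≠ Sum.inl v₀ → s ∈ locAt W 2 v) → s ∉ strictAt W 2 (pl ℓ) →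
        s ∉ strictAt W 2 (Sum.inl v₀) := by
  intro ℓ hKol
  obtain ⟨hℓ, hℓ2, hℓd, hgood, -, hFrob, hidx, -⟩ := hKol
  haveI : Fact ℓ.Prime := ⟨hℓ⟩
  rw [pl_of_prime hℓ]
  exact rec₁_inl W hΔ hℓ2 (natCast_mem_primesEquiv_symm hℓ) hgood hFrob hidx v₀ (ne_primesEquiv_symm_of_dvd_discr hq₀ hq₀d hq₀v hℓ hℓd)

/-- **Field `rec₂`** for a globally minimal twin `Wd` (`d_K` odd). [cite: GrossLMS1991, §10, Prop. 8.2] [cite: McCallumLMS1991, §5 Lemma 5.3] -/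
theorem rec₂_field (hΔ : W.Δ < 0) (hK : IsImaginaryQuadratic K) (hodd : Odd (NumberField.discr K))
    (Wd : WeierstrassCurve ℚ) [Wd.IsElliptic] [Wd.IsGloballyMinimal] {Cd : VariableChange ℚ}
    (hWd : Cd • W.quadraticTwist ((NumberField.discr K : ℤ) : ℚ) = Wd)
    {q₀ : ℕ} (hq₀ : q₀.Prime) (hq₀d : (q₀ : ℤ) ∣ NumberField.discr K) {v₀ : HeightOneSpectrum (𝓞 ℚ)} (hq₀v : (q₀ : 𝓞 ℚ) ∈ v₀.asIdeal) :
    ∀ ℓ, kolPrime W K 1 ℓ → ∀ d : galH1Torsion Wd 2, (∀ v : RatPlace, v ≠ pl ℓ → v ≠ Sum.inl v₀ → d ∈ locAt Wd 2 v) → d ∉ locAt Wd 2 (pl ℓ) →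
      ∀ s : galH1Torsion Wd 2, (∀ v : RatPlace, v ≠ Sum.inl v₀ → s ∈ locAt Wd 2 v) → s ∉ strictAt Wd 2 (pl ℓ) →
        s ∉ strictAt Wd 2 (Sum.inl v₀) := by
  intro ℓ hKol
  obtain ⟨hℓ, hℓ2, hℓd, hgood, -, hFrob, hidx, -⟩ := hKol
  haveI : Fact ℓ.Prime := ⟨hℓ⟩
  rw [pl_of_prime hℓ]
  exact rec₂_inl W hΔ hK hodd Wd hWd hℓ2 hℓd hgood hFrob (natCast_mem_primesEquiv_symm hℓ) hidx v₀
    (ne_primesEquiv_symm_of_dvd_discr hq₀ hq₀d hq₀v hℓ hℓd)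

/-! ## §3 The fields `ceb₁` / `ceb₂` / `ceb₂'` for `Kol := kolPrime W K 1`, `pl := pl`, unconditional on the `Δ_W < 0` habitat -/

/-- **Field `ceb₁`**: a `kolPrime W K 1` prime at whose place `y ≠ 0` does not vanish. [cite: McCallumLMS1991, §3 Cor. 3.2] [cite: GrossLMS1991, §10] -/
theorem ceb₁_field (hN : W.conductorNorm ℤ ∣ N) (hcm : ¬ W.HasCM) (hΔ : W.Δ < 0) (hK : IsImaginaryQuadratic K)
    (hodd : Odd (NumberField.discr K)) (hns : ¬ IsSquare ((NumberField.discr K : ℚ) * -|W.Δ|))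
    (hρ : ∀ n : ℕ, W.HasSurjectiveModNGaloisRep (2 ^ n : ℕ))
    {θ : K} (hθ : θ ∉ Set.range (algebraMap ℚ K)) (hc : θ ^ 2 = algebraMap ℚ K ((NumberField.discr K : ℤ) : ℚ))
    {y : galH1Torsion W 2} (hy0 : y ≠ 0) :
    ∃ ℓ, kolPrime W K 1 ℓ ∧ y ∉ strictAt W 2 (pl ℓ) := by
  obtain ⟨ℓ, -, hFrob, hKol, hidx, hloc⟩ :=
    ceb₁_rat N W hN hcm hΔ hK hodd hns hρ hθ hc (hinjK_of_habitat W K hK hΔ hρ hns) y hy0 0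
  refine ⟨ℓ, kolPrime_one_of_isKolyvaginPrime N W hN hK.1 hKol hFrob hidx, ?_⟩
  rw [pl_of_prime hKol.1, strictAt_inl]
  exact hloc _ (natCast_mem_primesEquiv_symm hKol.1)

/-- **Field `ceb₂`**: for `s ∉ {0, y}` a `kolPrime W K 1` prime at whose place neither `s` nor `y` vanishes (the relaxedness hypothesis of the
field is not needed). [cite: McCallumLMS1991, §3 Cor. 3.2] [cite: GrossLMS1991, Prop. 9.1, §10] -/
theorem ceb₂_field (hN : W.conductorNorm ℤ ∣ N) (hcm : ¬ W.HasCM) (hΔ : W.Δ < 0) (hK : IsImaginaryQuadratic K)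
    (hodd : Odd (NumberField.discr K)) (hns : ¬ IsSquare ((NumberField.discr K : ℚ) * -|W.Δ|))
    (hρ : ∀ n : ℕ, W.HasSurjectiveModNGaloisRep (2 ^ n : ℕ))
    {θ : K} (hθ : θ ∉ Set.range (algebraMap ℚ K)) (hc : θ ^ 2 = algebraMap ℚ K ((NumberField.discr K : ℤ) : ℚ))
    (y : galH1Torsion W 2) (hy0 : y ≠ 0) (q₀ : RatPlace) :
    ∀ s : galH1Torsion W 2, s ≠ 0 → s ≠ y → (∀ v : RatPlace, v ≠ q₀ → s ∈ locAt W 2 v) →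
      ∃ ℓ, kolPrime W K 1 ℓ ∧ s ∉ strictAt W 2 (pl ℓ) ∧ y ∉ strictAt W 2 (pl ℓ) := by
  intro s hs0 hsy _
  obtain ⟨ℓ, -, hFrob, hKol, hidx, hloc⟩ :=
    ceb₂_rat N W hN hcm hΔ hK hodd hns hρ hθ hc (hinjK_of_habitat W K hK hΔ hρ hns) s y hs0 hy0 hsy 0
  refine ⟨ℓ, kolPrime_one_of_isKolyvaginPrime N W hN hK.1 hKol hFrob hidx, ?_, ?_⟩
  · rw [pl_of_prime hKol.1, strictAt_inl]
    exact (hloc _ (natCast_mem_primesEquiv_symm hKol.1)).1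
  · rw [pl_of_prime hKol.1, strictAt_inl]
    exact (hloc _ (natCast_mem_primesEquiv_symm hKol.1)).2

/-- **Field `ceb₂'` for the twist EQUATION `W^{(d_K)}`, generic case** (`hPsiKT (res s') ≠ res y`; the «twin copy of `y`» is the lead's
`hceb₂_of_visible₂` case). [cite: McCallumLMS1991, §3 Cor. 3.2 and p. 299] [cite: Kolyvagin1989Izv, §3] -/
theorem ceb₂'_field_of_ne (hN : W.conductorNorm ℤ ∣ N) (hcm : ¬ W.HasCM) (hΔ : W.Δ < 0) (hK : IsImaginaryQuadratic K)
    (hodd : Odd (NumberField.discr K)) (hns : ¬ IsSquare ((NumberField.discr K : ℚ) * -|W.Δ|))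
    (hρ : ∀ n : ℕ, W.HasSurjectiveModNGaloisRep (2 ^ n : ℕ))
    {θ : K} (hθ : θ ∉ Set.range (algebraMap ℚ K)) (hc : θ ^ 2 = algebraMap ℚ K ((NumberField.discr K : ℤ) : ℚ))
    [(W.quadraticTwist ((NumberField.discr K : ℤ) : ℚ)).IsElliptic]
    (y : galH1Torsion W 2) (hy0 : y ≠ 0) (q₀ : RatPlace) :
    ∀ s' : galH1Torsion (W.quadraticTwist ((NumberField.discr K : ℤ) : ℚ)) 2, s' ≠ 0 →
      hPsiKT W K hθ hc ((2 : ℕ) : ℤ) (resTorsion (W.quadraticTwist ((NumberField.discr K : ℤ) : ℚ)) K ((2 : ℕ) : ℤ) s') ≠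
        resTorsion W K ((2 : ℕ) : ℤ) y →
      (∀ v : RatPlace, v ≠ q₀ → s' ∈ locAt (W.quadraticTwist ((NumberField.discr K : ℤ) : ℚ)) 2 v) →
      ∃ ℓ, kolPrime W K 1 ℓ ∧ s' ∉ strictAt (W.quadraticTwist ((NumberField.discr K : ℤ) : ℚ)) 2 (pl ℓ) ∧ y ∉ strictAt W 2 (pl ℓ) := by
  intro s' hs0 hne _
  obtain ⟨ℓ, -, hFrob, hKol, hidx, hloc⟩ :=
    ceb₂'_rat N W hN hcm hΔ hK hodd hns hρ hθ hc (hinjK_of_habitat W K hK hΔ hρ hns) s' y hs0 hy0 hne 0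
  refine ⟨ℓ, kolPrime_one_of_isKolyvaginPrime N W hN hK.1 hKol hFrob hidx, ?_, ?_⟩
  · rw [pl_of_prime hKol.1, strictAt_inl]
    exact (hloc _ (natCast_mem_primesEquiv_symm hKol.1)).1
  · rw [pl_of_prime hKol.1, strictAt_inl]
    exact (hloc _ (natCast_mem_primesEquiv_symm hKol.1)).2

end Rat

end Summit.BirchSwinnertonDyer.BirchSwinnertonDyer.Theorems.RankOneAtTwoOneDoor

end
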